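import Summits.BirchSwinnertonDyer.BirchSwinnertonDyer.Theorems.KimAtThreeStubBlindClasses
import Summits.BirchSwinnertonDyer.Rank1Residual.GaloisImage.KolyvaginCoreGraphConnected
import Summits.BirchSwinnertonDyer.Rank1Residual.GaloisImage.KolyvaginCoreTransport
import HarnessLib

/-!
# Route `KimAtThreeKolyvagin` (rung W2), crux `StubAtEmptyLevelThree` (item 19561): at `m = 1`
# an `ℕ`-cyclic SUB-datum contains a core vertex of the full datum, and its `ℕ`-generator is the
# restriction of an `ℕ`-generator of the full datum — the `∀`-sub-data quantifier, third instalment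

Cell `bsd-addord`, seat `bsd-addord-w2-c5` (gen 2; item `stmt-BirchSwinnertonDyer-19561`).  TOOL
theorems (no definition, no named fact, no `sorry`), in the abstract residual setting of team
n1011's `CoreRankOne` files (R1-56 (G)): `K` a number field, `M = T̄` finite with `p·M = 0`, a
Poitou–Tate family `inv` (`IsPerfect`, `SumLocalTermEqZero`, `SelmerComplement`,
`UnramifiedOrthogonal`), `𝓕` unramified outside `S` with finite Selmer and dual Selmer groups,
residually coisotropic for a self-duality `θ : M ⥲ M^D` (inverse `θ′`), a Kolyvagin datum `D` with
`𝒫 ∩ S = ∅` and the local shape `#H¹_ur = #H¹_tr = p`, `H¹ = H¹_ur + H¹_tr`, `θ`-self-dual transverse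
conditions at `𝒫`.

WHY.  The crux quantifies over every sub-datum `𝒫′ ⊆ 𝒫` of a Sakamoto `τ`-class and asks, WHEN
`KS₁(T, 𝓕, 𝒫′)` is `ℕ`-cyclic, for the stub shape of the generator's bottom class; print treats only
the full class.  `KimAtThreeStubSubdatum` (p447489) transfers the stub to sub-data keeping an
injectivity vertex; `KimAtThreeStubBlindClasses` (p474354) shows that `ℕ`-cyclicity with one prime
forces `B(𝒫′) = 0` (no non-zero `𝒫′`-blind Selmer class).  This file closes the gap between the two
at the residual level `m = 1` WITHOUT any Chebotarev input on `𝒫′`: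

* §1 `dualSelmerGroup_atLevel_insert_le` — if some class of `H¹_{𝓕(d)}(K, M)` is non-zero at the
  Kolyvagin prime `𝔮 ∉ d`, then `H¹_{𝓕(d𝔮)^*}(K, M^D) ≤ H¹_{𝓕(d)^*}(K, M^D)` (the containment behind
  n1011's strict count `CoreRankZero.card_dualSelmerGroup_atLevel_insert_lt`; Rubin Cor. 2.6.2 (2),
  (4)).
* §2 ★ `exists_core_subset_of_forall_dualTransported_visible` — **core vertices inside any
  dual-visible prime set**: if every non-zero class of the transported dual Selmer group
  `H¹_{θ^*𝓕^*}(K, M)` is non-zero at some prime of a subset `P ⊆ 𝒫`, then some level `e ⊆ P` is a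
  core vertex (`H¹_{𝓕(e)^*}(K, M^D) = 0`).  Greedy induction on `#H¹_{𝓕(e)^*}`: a non-zero dual class
  `z ∈ H¹_{𝓕(e)^*} ≤ H¹_{𝓕^*}` transports to `y = H¹(θ′) z ∈ H¹_{θ^*𝓕(e)^*} ≤ H¹_{𝓕(e)}` (coisotropy,
  Sakamoto p. 931) and `y ∈ H¹_{θ^*𝓕^*} ≤ H¹_𝓕`; a prime `r ∈ P` seeing `y` is outside `e` (`y` is
  unramified and transverse at the primes of `e`) and sees `z`, so `H¹_{𝓕(er)^*} < H¹_{𝓕(e)^*}`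
  (Rubin Cor. 2.6.2 (4)) and `H¹_{𝓕(er)^*} ≤ H¹_{𝓕(e)^*} ≤ H¹_{𝓕^*}` (§1).  This is Rubin's Cor. 2.7.3
  / n1011's `CoreRankOne.exists_core_superset` with the prime-CHOICE hypothesis replaced by prime
  VISIBILITY on a prescribed set.
* §3 ★ `exists_restrict_eq_of_forall_eq_nsmul_of_nonempty` — **the sub-datum theorem at `m = 1`**:
  under the full n1011 package for `D` (core rank one, the prime choices `hch3`/`hL52` of Sakamoto
  Cor. 5.5 / Lemma 5.2 FOR `D`, admissible comparison maps) and `#KS₁(T, 𝓕, 𝒫) ≥ p`, for EVERY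
  sub-datum `D′ ⊑ D` (`𝒫′ ⊆ 𝒫`, `𝒫′ ≠ ∅`, same transverse conditions and comparison maps) whose
  `KS₁(T, 𝓕, 𝒫′) = ℕ•g′` is `ℕ`-cyclic, `g′` is the restriction of an `ℕ`-generator `κ` of
  `KS₁(T, 𝓕, 𝒫)` (so `g′_1 = κ_1`): `ℕ`-cyclicity ⇒ `B(𝒫′) = 0` (p474354) ⇒ every transported dual
  class is visible on `𝒫′` ⇒ a core vertex `e ⊆ 𝒫′` (§2) ⇒ evaluation at `e` is injective on
  `KS₁(T, 𝓕, 𝒫)` (n1011 `CoreRankOne.injective_eval_kolyvaginSystems_of_core`, the core graph being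
  connected) ⇒ restriction is a bijection onto `KS₁(T, 𝓕, 𝒫′)` (p447489
  `KSSub.exists_restrict_eq_of_injective_eval`).
Reading for the item (memo `STUB19561-BLIND-w2c5g2.md`): at `m = 1` the `∀`-sub-data form of the
stub is EQUIVALENT to the full-data form given the printed full-data theory; the crux's only
defect as an item is the missing PUB antecedents (Poitou–Tate, [S24]).  What is NOT here: `m ≥ 2`
(the same argument run on `T̄ = T/𝔪T` needs the cartesian descent `H¹_{𝓕(e)^*}(T^*)[𝔪] ≅
H¹_{𝓕̄(e)^*}(T̄^*)`, Mazur–Rubin Lemma 3.5.3 — recorded in the memo, not typed); the `E[3]` instance.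
[cite: Rubin2011, Cor. 2.6.2, Cor. 2.7.3 and Cor. 2.8.9 (2) (pp. 22–25)]
[cite: Sakamoto2024, Lemma 6.1 and §6, proof of Lemma 6.4 (pp. 930–931), Thm. 4.4 (1) (p. 926)]
[cite: MazurRubin2004, Thm. 4.4.1 and Lemma 3.5.3]
-/

set_option autoImplicit false
-- the Theorems namespace of a single-conjunct summit repeats the summit name by design (D-0017)
set_option linter.dupNamespace false

noncomputable section

open scoped Classical NumberField ContRepresentation
open Function NumberField IsDedekindDomain
  Literature.NumberTheory.GaloisRepresentations
  Literature.NumberTheory.GaloisRepresentations.DiscreteGaloisModule Literature.NumberTheory.GaloisCohomology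
  Summit.BirchSwinnertonDyer.Rank1Residual.GaloisImage
  Summit.BirchSwinnertonDyer.Rank1Residual.GaloisImage.CoreRankZero
  Summit.BirchSwinnertonDyer.Rank1Residual.X11b.Levels

universe u

namespace Summit.BirchSwinnertonDyer.BirchSwinnertonDyer.Theorems.KimAtThreeStubCoreVertexInside

variable {K : Type u} [Field K] [NumberField K]
variable {M : Type u} [AddCommGroup M] [TopologicalSpace M] [DiscreteTopology M] [Finite M]
variable {ρ : DiscreteGaloisModule K M}

/-! ## §1 The dual Selmer group does not grow along a `T`-visible edge -/

/-- **`H¹_{𝓕(d𝔮)^*}(K, M^D) ≤ H¹_{𝓕(d)^*}(K, M^D)` when some class of `H¹_{𝓕(d)}(K, M)` is non-zero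
at the Kolyvagin prime `𝔮 ∉ d`**: a dual class transverse at `𝔮` satisfies the relaxed-at-`𝔮` dual
condition, and `H¹_{𝓕_𝔮(d)^*} = H¹_{𝓕(d)^*}` by Rubin's Prop. 2.6.1 with `c = 1` (n1011
`CoreRankZero.dualSelmerGroup_strictAt_eq`).  The containment behind the strict count
`card_dualSelmerGroup_atLevel_insert_lt`. [cite: Rubin2011, Prop. 2.6.1 and Cor. 2.6.2 (2) (p. 22)] -/
theorem dualSelmerGroup_atLevel_insert_le {p : ℕ} [Fact p.Prime] {inv : LocalInvariants K p}
    (hperf : inv.IsPerfect) (hsum : inv.SumLocalTermEqZero) (hcompl : inv.SelmerComplement)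
    (hM : ∀ m : M, p • m = 0) {S : Finset (Place K)}
    (hS : ∀ v : HeightOneSpectrum (𝓞 K), (Sum.inr v : Place K) ∉ S →
      ((p : ℕ) : 𝓞 K) ∉ v.asIdeal ∧ GaloisRep.IsUnramifiedAt v ρ)
    {𝓕 : SelmerStructure ρ} (h𝓕 : 𝓕.IsUnramifiedOutside S)
    (hfin : Finite 𝓕.selmerGroup) (hfind : Finite (inv.dualSelmerStructure ρ 𝓕).selmerGroup)
    {D : KolyvaginDatum ρ} (hPS : ∀ q ∈ D.primes, (Sum.inr q : Place K) ∉ S)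
    (hU : ∀ q ∈ D.primes, Nat.card (unramifiedSubgroup (GaloisRep.toLocal q ρ) 1) = p)
    (d : Finset (HeightOneSpectrum (𝓞 K))) {q : HeightOneSpectrum (𝓞 K)}
    (hq : q ∈ D.primes) (hqd : q ∉ d) {x : galoisCohomology ρ 1}
    (hx : x ∈ (D.atLevel 𝓕 d).selmerGroup)
    (hxq : galoisCohomology.localization ρ (Sum.inr q) 1 x ≠ 0) :
    (inv.dualSelmerStructure ρ (D.atLevel 𝓕 (insert q d))).selmerGroup ≤
      (inv.dualSelmerStructure ρ (D.atLevel 𝓕 d)).selmerGroup := by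
  haveI := DiscreteGaloisModule.TateDual.finite K M p
  have hEq := dualSelmerGroup_strictAt_eq hperf hsum hcompl hM hS h𝓕 hfin hfind hPS hU d hq hqd hx hxq
  intro z hz
  have hzA : z ∈ (inv.dualSelmerStructure ρ ((D.atLevel 𝓕 d).strictAt {q})).selmerGroup := by
    refine mem_selmerGroup_of_forall_ne q (fun v hv => le_of_eq ?_) hz ?_
    · rw [LocalInvariants.dualSelmerStructure_apply, LocalInvariants.dualSelmerStructure_apply,
        Level.atLevel_insert_apply_of_ne D 𝓕 q hv, Level.strictAt_apply_of_ne _ q hv]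
    · rw [LocalInvariants.dualSelmerStructure_apply, Level.strictAt_inr_self,
        LocalInvariants.dualLocalCondition_bot]
      exact AddSubgroup.mem_top _
  rwa [hEq] at hzA

/-! ## §2 Core vertices inside any dual-visible set of Kolyvagin primes -/

/-- ★ **Core vertices inside any dual-visible prime set (`m = 1`).**  Let `P ⊆ 𝒫(D)` be ANY subset
such that every non-zero class of the transported dual Selmer group `H¹_{θ^*𝓕^*}(K, M)` is
non-zero at some prime of `P`.  Then some level `e` with `e ⊆ P` is a core vertex:
`H¹_{𝓕(e)^*}(K, M^D) = 0`.  (Greedy induction on `#H¹_{𝓕(e)^*}` along levels `e ⊆ P` with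
`H¹_{𝓕(e)^*} ≤ H¹_{𝓕^*}`: a non-zero dual class `z` transports to `y = H¹(θ′) z ∈ H¹_{𝓕(e)} ∩ H¹_𝓕` by
coisotropy; a prime `r ∈ P` seeing `y` lies outside `e` — there `y` would be unramified and
transverse — and sees `z`, so the dual Selmer group drops strictly from `e` to `er` (Rubin
Cor. 2.6.2 (4)) inside `H¹_{𝓕(e)^*}` (§1).)  Rubin's Cor. 2.7.3 with prime CHOICE replaced by prime
VISIBILITY on a prescribed set; no Chebotarev input. [cite: Rubin2011, Cor. 2.6.2 (4) and Cor. 2.7.3 (pp. 23–24)]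
[cite: Sakamoto2024, §6, proof of Lemma 6.4 (p. 931)] -/
theorem exists_core_subset_of_forall_dualTransported_visible {p : ℕ} [Fact p.Prime]
    {inv : LocalInvariants K p}
    (θ : ρ.toContRepresentation →ⁱL (ρ.tateDual p).toContRepresentation)
    (θ' : (ρ.tateDual p).toContRepresentation →ⁱL ρ.toContRepresentation)
    (hperf : inv.IsPerfect) (hsum : inv.SumLocalTermEqZero) (hcompl : inv.SelmerComplement)
    (hur : inv.UnramifiedOrthogonal) (hM : ∀ m : M, p • m = 0) {S : Finset (Place K)}
    (hS : ∀ v : HeightOneSpectrum (𝓞 K), (Sum.inr v : Place K) ∉ S →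
      ((p : ℕ) : 𝓞 K) ∉ v.asIdeal ∧ GaloisRep.IsUnramifiedAt v ρ)
    {𝓕 : SelmerStructure ρ} (h𝓕 : 𝓕.IsUnramifiedOutside S)
    (hfin : Finite 𝓕.selmerGroup) (hfind : Finite (inv.dualSelmerStructure ρ 𝓕).selmerGroup)
    (hθθ' : ∀ a : M, θ' (θ a) = a) (hθ'θ : ∀ b, θ (θ' b) = b)
    (hcois : inv.IsResiduallyCoisotropic 𝓕 θ S)
    {D : KolyvaginDatum ρ} (hPS : ∀ q ∈ D.primes, (Sum.inr q : Place K) ∉ S)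
    (hadm : D.IsAdmissible)
    (hU : ∀ q ∈ D.primes, Nat.card (unramifiedSubgroup (GaloisRep.toLocal q ρ) 1) = p)
    (hT : ∀ q ∈ D.primes, Nat.card (D.transverse (Sum.inr q)) = p)
    (hUT : ∀ q ∈ D.primes,
      unramifiedSubgroup (GaloisRep.toLocal q ρ) 1 ⊔ D.transverse (Sum.inr q) = ⊤)
    (hTθ : ∀ q ∈ D.primes, (inv.dualLocalCondition ρ (Sum.inr q) (D.transverse (Sum.inr q))).comap
      (localMap θ (Sum.inr q)) = D.transverse (Sum.inr q))
    {P : Set (HeightOneSpectrum (𝓞 K))} (hP : P ⊆ D.primes)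
    (hvis : ∀ y ∈ (inv.dualTransported 𝓕 θ).selmerGroup, y ≠ 0 →
      ∃ r ∈ P, galoisCohomology.localization ρ (Sum.inr r) 1 y ≠ 0) :
    ∃ e : Finset (HeightOneSpectrum (𝓞 K)), ↑e ⊆ P ∧
      (inv.dualSelmerStructure ρ (D.atLevel 𝓕 e)).selmerGroup = ⊥ := by
  classical
  haveI := DiscreteGaloisModule.TateDual.finite K M p
  have h0 : D.atLevel 𝓕 ∅ = 𝓕 := SelmerStructure.modify_empty 𝓕 D.transverse
  suffices h : ∀ (N : ℕ) (e : Finset (HeightOneSpectrum (𝓞 K))), ↑e ⊆ P →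
      (inv.dualSelmerStructure ρ (D.atLevel 𝓕 e)).selmerGroup ≤
        (inv.dualSelmerStructure ρ 𝓕).selmerGroup →
      Nat.card (inv.dualSelmerStructure ρ (D.atLevel 𝓕 e)).selmerGroup = N →
        ∃ e' : Finset (HeightOneSpectrum (𝓞 K)), ↑e' ⊆ P ∧
          (inv.dualSelmerStructure ρ (D.atLevel 𝓕 e')).selmerGroup = ⊥ by
    have hle0 : (inv.dualSelmerStructure ρ (D.atLevel 𝓕 ∅)).selmerGroup ≤
        (inv.dualSelmerStructure ρ 𝓕).selmerGroup := le_of_eq (by rw [h0])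
    exact h _ ∅ (by simp) hle0 rfl
  intro N
  induction N using Nat.strong_induction_on with
  | _ N ih =>
    intro e heP hle hN
    by_cases hbot : (inv.dualSelmerStructure ρ (D.atLevel 𝓕 e)).selmerGroup = ⊥
    · exact ⟨e, heP, hbot⟩
    have he : D.IsLevel e := fun r hr => hP (heP hr)
    obtain ⟨z, hz, hz0⟩ := (AddSubgroup.bot_or_exists_ne_zero _).resolve_left hbot
    -- transport the dual class: `y = H¹(θ′) z ∈ H¹_{θ^*𝓕(e)^*} ≤ H¹_{𝓕(e)}` and `y ∈ H¹_{θ^*𝓕^*} ≤ H¹_𝓕`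
    set y : galoisCohomology ρ 1 := galoisCohomology.map θ' 1 z with hydef
    have hθy : galoisCohomology.map θ 1 y = z := map_map_eq_self_of_comp_eq θ' θ hθ'θ z
    have hy0 : y ≠ 0 := fun h => hz0 (by rw [← hθy, h, map_zero])
    have hye : y ∈ (inv.dualTransported (D.atLevel 𝓕 e) θ).selmerGroup := by
      rw [CoreRankOne.mem_selmerGroup_dualTransported_iff, hθy]; exact hz
    have hy𝓕 : y ∈ (inv.dualTransported 𝓕 θ).selmerGroup := by
      rw [CoreRankOne.mem_selmerGroup_dualTransported_iff, hθy]; exact hle hz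
    have hyHe : y ∈ (D.atLevel 𝓕 e).selmerGroup :=
      CoreRankOne.selmerGroup_dualTransported_atLevel_le θ θ' hur hM hS h𝓕 hθθ' hcois hTθ he hye
    have hyH : y ∈ 𝓕.selmerGroup := by
      have h' := CoreRankOne.selmerGroup_dualTransported_atLevel_le θ θ' hur hM hS h𝓕 hθθ' hcois hTθ
        (D := D) D.isLevel_empty
      rw [h0] at h'
      exact h' hy𝓕
    -- a prime of `P` seeing `y`; it lies outside `e` (there `y` is unramified AND transverse)
    obtain ⟨r, hrP, hyr⟩ := hvis y hy𝓕 hy0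
    have hr : r ∈ D.primes := hP hrP
    have hre : r ∉ e := by
      intro hre
      apply hyr
      have h1 := (SelmerStructure.mem_selmerGroup_iff _ _).1 hyH (Sum.inr r)
      rw [h𝓕.2 r (hPS r hr)] at h1
      have h2 := (SelmerStructure.mem_selmerGroup_iff _ _).1 hyHe (Sum.inr r)
      rw [Level.atLevel_inr_of_mem D 𝓕 hre] at h2
      have h12 := AddSubgroup.mem_inf.2 ⟨h1, h2⟩
      exact (AddSubgroup.mem_bot).1
        ((CoreRankOne.unramified_inf_transverse_eq_bot hadm hU hT hUT hr).le h12)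
    -- `r` sees `z` too, so the dual Selmer group drops strictly from `e` to `er`, inside `H^*(e)`
    have hzr : galoisCohomology.localization (ρ.tateDual p) (Sum.inr r) 1 z ≠ 0 := by
      rw [← hθy]; exact (CoreRankOne.localization_map_ne_zero_iff θ θ' hθθ' _ y).2 hyr
    have hlt := card_dualSelmerGroup_atLevel_insert_lt hperf hsum hcompl hM hS h𝓕 hfin hfind hPS hU
      hUT e hr hre hyHe hyr hz hzr
    have hsub := dualSelmerGroup_atLevel_insert_le hperf hsum hcompl hM hS h𝓕 hfin hfind hPS hU e hr
      hre hyHe hyr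
    exact ih _ (hN ▸ hlt) (insert r e)
      (by rw [Finset.coe_insert]; exact Set.insert_subset hrP heP) (hsub.trans hle) rfl

/-! ## §3 The sub-datum theorem at `m = 1` -/

/-- ★ **At `m = 1`, the `ℕ`-generator of ANY non-empty `ℕ`-cyclic sub-datum is the restriction of an
`ℕ`-generator of the full datum.**  Setting: the n1011 `CoreRankOne` package for `(K, M, inv, 𝓕,
θ, D)` — Poitou–Tate family, `𝓕` unramified outside `S` with finite (dual) Selmer groups, residually
coisotropic, CORE RANK ONE, `D` admissible with the Kolyvagin-prime local shape at `𝒫 ∩ S = ∅`, and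
the prime choices over `H¹(K, M)` FOR `D` (`hch3`: Sakamoto Cor. 5.5; `hL52`: Lemma 5.2) — together
with `#KS₁(T, 𝓕, 𝒫(D)) ≥ p` (a non-zero Kolyvagin system exists; the `Nonempty (… ≃+ ZMod p)` clause
of [S24] Thm. 4.4 (1)).  Let `D′` be a sub-datum (`𝒫(D′) ⊆ 𝒫(D)` non-empty, the same transverse
conditions, the same comparison maps on `𝒫(D′)`) with `KS₁(T, 𝓕, 𝒫(D′)) = ℕ•g′`.  THEN there is
`κ ∈ KS₁(T, 𝓕, 𝒫(D))` with `KS₁(T, 𝓕, 𝒫(D)) = ℕ•κ` whose restriction to the levels of `D′` is `g′`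
— in particular `g′_1 = κ_1`, so every statement about the bottom class of the generator of the FULL
datum (the stub at the empty level) holds verbatim for the sub-datum.  Chain: `ℕ`-cyclicity ⇒
`B(𝒫′) = 0` (`KSBlind.eq_zero_of_forall_eq_nsmul`) ⇒ every transported dual class is visible on
`𝒫′` (coisotropy puts it in `H¹_𝓕`) ⇒ a core vertex `e ⊆ 𝒫′` (§2) ⇒ evaluation at `e` is injective on
`KS₁(T, 𝓕, 𝒫)` (`CoreRankOne.injective_eval_kolyvaginSystems_of_core`) ⇒ restriction is a bijection
onto `KS₁(T, 𝓕, 𝒫′)` (`KSSub.exists_restrict_eq_of_injective_eval`).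
[cite: Sakamoto2024, Thm. 4.4 (1) (p. 926), Prop. 7.6 (p. 936)] [cite: Rubin2011, Cor. 2.7.3 and Cor. 2.8.9 (2) (pp. 24–25)]
[cite: MazurRubin2004, Thm. 4.4.1] -/
theorem exists_restrict_eq_of_forall_eq_nsmul_of_nonempty {p : ℕ} [Fact p.Prime]
    {inv : LocalInvariants K p}
    (θ : ρ.toContRepresentation →ⁱL (ρ.tateDual p).toContRepresentation)
    (θ' : (ρ.tateDual p).toContRepresentation →ⁱL ρ.toContRepresentation)
    (hperf : inv.IsPerfect) (hsum : inv.SumLocalTermEqZero) (hcompl : inv.SelmerComplement)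
    (hur : inv.UnramifiedOrthogonal) (hM : ∀ m : M, p • m = 0) {S : Finset (Place K)}
    (hS : ∀ v : HeightOneSpectrum (𝓞 K), (Sum.inr v : Place K) ∉ S →
      ((p : ℕ) : 𝓞 K) ∉ v.asIdeal ∧ GaloisRep.IsUnramifiedAt v ρ)
    {𝓕 : SelmerStructure ρ} (h𝓕 : 𝓕.IsUnramifiedOutside S)
    (hfin : Finite 𝓕.selmerGroup) (hfind : Finite (inv.dualSelmerStructure ρ 𝓕).selmerGroup)
    (hθθ' : ∀ a : M, θ' (θ a) = a) (hθ'θ : ∀ b, θ (θ' b) = b)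
    (hcois : inv.IsResiduallyCoisotropic 𝓕 θ S) (hχ : LocalInvariants.HasCoreRank inv 𝓕 p 1)
    {D : KolyvaginDatum ρ} (hPS : ∀ q ∈ D.primes, (Sum.inr q : Place K) ∉ S)
    (hadm : D.IsAdmissible)
    (hU : ∀ q ∈ D.primes, Nat.card (unramifiedSubgroup (GaloisRep.toLocal q ρ) 1) = p)
    (hT : ∀ q ∈ D.primes, Nat.card (D.transverse (Sum.inr q)) = p)
    (hUT : ∀ q ∈ D.primes,
      unramifiedSubgroup (GaloisRep.toLocal q ρ) 1 ⊔ D.transverse (Sum.inr q) = ⊤)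
    (hTθ : ∀ q ∈ D.primes, (inv.dualLocalCondition ρ (Sum.inr q) (D.transverse (Sum.inr q))).comap
      (localMap θ (Sum.inr q)) = D.transverse (Sum.inr q))
    (hch3 : ∀ c₁ c₂ c₃ : galoisCohomology ρ 1, c₁ ≠ 0 → c₂ ≠ 0 → c₃ ≠ 0 →
      {q ∈ D.primes | galoisCohomology.localization ρ (Sum.inr q) 1 c₁ ≠ 0 ∧
        galoisCohomology.localization ρ (Sum.inr q) 1 c₂ ≠ 0 ∧
        galoisCohomology.localization ρ (Sum.inr q) 1 c₃ ≠ 0}.Infinite)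
    (hL52 : ∀ c₁ c₂ c₃ c₄ : galoisCohomology ρ 1,
      (∀ a : Fin 3 → ZMod p, (∑ i, (a i).val • ![c₁, c₂, c₃] i) = 0 → a = 0) → c₄ ≠ 0 →
      {q ∈ D.primes | galoisCohomology.localization ρ (Sum.inr q) 1 c₁ ≠ 0 ∧
        galoisCohomology.localization ρ (Sum.inr q) 1 c₂ ≠ 0 ∧
        galoisCohomology.localization ρ (Sum.inr q) 1 c₃ ≠ 0 ∧
        galoisCohomology.localization ρ (Sum.inr q) 1 c₄ ≠ 0}.Infinite)
    (hKS : p ≤ Nat.card (D.kolyvaginSystems 𝓕))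
    {D' : KolyvaginDatum ρ} (hPP : D'.primes ⊆ D.primes) (hT' : D'.transverse = D.transverse)
    (hfs : ∀ q ∈ D'.primes, D'.fs q = D.fs q) (hne : D'.primes.Nonempty)
    {g' : Finset (HeightOneSpectrum (𝓞 K)) → galoisCohomology ρ 1}
    (hg' : g' ∈ D'.kolyvaginSystems 𝓕)
    (hgen' : ∀ κ' ∈ D'.kolyvaginSystems 𝓕, ∃ a : ℕ, κ' = a • g') :
    ∃ κ ∈ D.kolyvaginSystems 𝓕, (∀ κ₁ ∈ D.kolyvaginSystems 𝓕, ∃ a : ℕ, κ₁ = a • κ) ∧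
      (fun d => if D'.IsLevel d then κ d else 0) = g' := by
  have hp : p.Prime := Fact.out
  have hMH : ∀ c : galoisCohomology ρ 1, p • c = 0 := galoisCohomology.nsmul_eq_zero_of_forall ρ hM
  have hMH1 : ∀ c : galoisCohomology ρ 1, p ^ 1 • c = 0 := fun c => by rw [pow_one]; exact hMH c
  obtain ⟨q₀, hq₀⟩ := hne
  -- (1) `ℕ`-cyclicity of `KS(D′)` kills every `𝒫(D′)`-blind class of `H¹_𝓕`
  have hblind : ∀ b ∈ 𝓕.selmerGroup,
      (∀ q ∈ D'.primes, galoisCohomology.localization ρ (Sum.inr q) 1 b = 0) → b = 0 :=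
    fun b hb hloc => KimAtThreeStubBlindClasses.KSBlind.eq_zero_of_forall_eq_nsmul D' 𝓕 hp 1 hMH1
      hgen' hq₀ hb hloc
  -- (2) hence every non-zero transported dual class is visible on `𝒫(D′)`
  have h0 : D.atLevel 𝓕 ∅ = 𝓕 := SelmerStructure.modify_empty 𝓕 D.transverse
  have hvis : ∀ y ∈ (inv.dualTransported 𝓕 θ).selmerGroup, y ≠ 0 →
      ∃ r ∈ D'.primes, galoisCohomology.localization ρ (Sum.inr r) 1 y ≠ 0 := by
    intro y hy hy0
    by_contra h
    have hyH : y ∈ 𝓕.selmerGroup := by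
      have h' := CoreRankOne.selmerGroup_dualTransported_atLevel_le θ θ' hur hM hS h𝓕 hθθ' hcois hTθ
        (D := D) D.isLevel_empty
      rw [h0] at h'
      exact h' hy
    exact hy0 (hblind y hyH fun q hq => by
      by_contra hq0
      exact h ⟨q, hq, hq0⟩)
  -- (3) a core vertex of `D` inside `𝒫(D′)`
  obtain ⟨e, heP, hcore⟩ := exists_core_subset_of_forall_dualTransported_visible θ θ' hperf hsum hcompl
    hur hM hS h𝓕 hfin hfind hθθ' hθ'θ hcois hPS hadm hU hT hUT hTθ hPP hvis
  have he : D.IsLevel e := fun r hr => hPP (heP hr)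
  have he' : D'.IsLevel e := heP
  -- (4) evaluation at `e` is injective on `KS(D)` (the core graph of `D` is connected)
  have hInj := CoreRankOne.injective_eval_kolyvaginSystems_of_core hperf hsum hcompl hur hM hS h𝓕 hfin
    hfind θ θ' hθθ' hθ'θ hcois hχ hPS hU hT hUT hTθ hch3 hL52 hadm he hcore
  have hinj : ∀ κ ∈ D.kolyvaginSystems 𝓕, κ e = 0 → κ = 0 := by
    intro κ hκ hκe
    have h := @hInj ⟨κ, hκ⟩ ⟨0, zero_mem _⟩ (Subtype.ext (by simpa using hκe))
    exact congrArg Subtype.val h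
  -- (5) restriction is a bijection onto the `ℕ`-cyclic `KS(D′)`
  exact KimAtThreeStubSubdatum.KSSub.exists_restrict_eq_of_injective_eval hPP hT' hfs hp.pos hMH hKS
    he' hinj hg' hgen'

end Summit.BirchSwinnertonDyer.BirchSwinnertonDyer.Theorems.KimAtThreeStubCoreVertexInside

end
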